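import Literature.Geometry.Kaehler.ComplexTorusCyclotomicAutomorphismFixedPoints
import Literature.Geometry.Kaehler.ComplexTorusCyclicGroupActionCM
import Literature.Geometry.Kaehler.ComplexTorusEndomorphismAlgebraProduct
import Literature.RepresentationTheory.VerySimpleRepresentations
import Literature.LinearAlgebra.Matrix.CentralizerSubfield
import Mathlib.NumberTheory.NumberField.Cyclotomic.Basic
import Mathlib.RingTheory.Finiteness.Nakayama
import Mathlib.RingTheory.Polynomial.Tower
import Mathlib.Algebra.Module.ZMod
import HarnessLib

/-!
# A very simple fixed module `A^δ` forces `End_δ(A) = ℤ[δ]` or `End_δ(A) = End_{ℤ[δ]}(Λ)` (Dolgachev–Zarhin, Theorem 2.18, at torus level)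

Layer `Literature/Geometry/Kaehler`, namespace `Literature.Geometry.Kaehler.ComplexTorus`; lane
`lit-hodgefound` (Track 2 foundations library), row g13-#1 of seat p11 (gen 13), FILE 2 of 2 — the sequel
of this seat's `ComplexTorusCyclotomicAutomorphismFixedPoints.lean` (gen 7: the ring `ℤ[δ]`, the fixed
group `A^δ = fixedSubgroup Φ D ≅ 𝔽_ℓ^r`, the centralizer `End_δ(A) = centralizerEnd Φ D`, Remark 2.17,
Lemma 2.19, the action (2.19) `fixedAction`) and `ComplexTorusVerySimpleTorsion.lean` (gen 8: Theorem
2.15 at torus level). Three definitions with bodies (`fixedSubgroupModule` — the `𝔽_ℓ`-structure of `A^δ`;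
`centralizerAction` — the action of the full commutant `End_{ℤ[δ]}(Λ)` on `A^δ`; `fixedImage` — the
subalgebra `R ⊂ End_{𝔽_ℓ}(A^δ)` of (2.19)); everything else is a THEOREM; no named fact (net debt 0).

## Source READ (held text), verbatim

I. Dolgachev, Yu. G. Zarhin, *Endomorphisms of Complex Abelian Varieties* (notes dated 31 July 2024; bib
`DolgachevZarhin2024`; held text `paper:galaxy-pdf-8712177384607648460`, chunks p0035–p0037), §2.2:

* (2.17)–(2.18), Remark 2.17 (p0035): "The rational representation of elements of `End_δ(A)` gives us
  the ring embedding `End_δ(A) ↪ End_ℤ(Λ)`. Its image lies in `End_{ℤ[δ]}(Λ)` […]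
  `μ_r : End_δ(A) ↪ End_{ℤ[δ]}(Λ)` (2.17). *Remark* 2.17. Comparing the ranks in (2.17), we obtain the
  inequality `d ≤ r²`. What will happen if the equality holds? It follows immediately that there is a
  positive integer `N` such that `N · End_{ℤ[δ]}(Λ) ⊂ ι_r(End_δ(A))`. We claim that in this case the
  embedding (2.17) is bijective […] `ι_r(End_δ(A)) = End_{ℤ[δ]}(Λ)` (2.18)."
* p0036 L9–L13: "Let `K` be a finitely generated subfield of `ℂ` such that `A` and its endomorphism `δ`
  are defined over `K`. […] `A^δ` is a `Gal(K)`-invariant `𝔽_ℓ`-vector subspace of `A[ℓ]`. The following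
  assertion may be viewed as a natural extension of Theorem 2.15. **Theorem 2.18.** Let `End(A)_δ` be the
  centralizer of `δ ∈ End(A)` and `End_ℚ(A)_δ = End(A)_δ ⊗ ℚ ⊂ End_ℚ(A)` be the corresponding
  `ℚ`-subalgebra of `End_ℚ(A)`. Suppose that the `Gal(K)`-module `A^δ` is very simple. Then, either
  `End(A)_δ = ℤ[δ]`, or `End_ℚ(A)_δ` is isomorphic to the matrix algebra of size `r` over the field
  `ℚ[δ]`. In the latter case, `A` is isogenous to a self-product `B^r` of a `(ℓ - 1)/2`-dimensional
  abelian variety `B` with `End_ℚ(B) ≅ ℚ(ζ_ℓ)`."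
* Proof (p0036 L15 – p0037 L3): "First, notice that `End_δ(A)` is a torsion free finitely generated
  `ℤ[δ]`-algebra, hence, is a projective `ℤ[δ]`-module of finite rank, say `d`. Hence, the quotient
  `End_δ(A)/(1-δ)End_δ(A)` is a `d`-dimensional `ℤ[δ]/(1-δ) = 𝔽_ℓ`-algebra. **Lemma 2.19.** […]
  End of Proof of Theorem 2.18 (modulo Lemma 2.19). It follows from Lemma 2.19 that the action of
  `End_δ(A)` on `A^δ` induces the `𝔽_ℓ`-algebra embedding
  `End_δ(A)/(1-δ)End_δ(A) ↪ End_{𝔽_ℓ}(A^δ)` (2.19). Since `A` and `δ` are defined over `K`, the image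
  `R` of the embedding (2.19) is a normal `Gal(K)`-subalgebra of `End_{𝔽_ℓ}(A^δ)`. Hence,
  `dim_{𝔽_ℓ}(R) = […] = d`. Since the Galois module `A^δ` is very simple, either `d = 1` or
  `d = dim_{𝔽_ℓ}(End_{𝔽_ℓ}(A^δ)) = (dim_{𝔽_ℓ}(A^δ))² = r²`. If `d = 1`, `End_δ(A)` is a projective
  `ℤ[δ]`-module of rank `1`, which implies easily that `ℤ[δ] ⊂ End_δ(A) ⊂ ℤ[δ] ⊗ ℚ`; the latter is
  isomorphic to the `ℓ`th cyclotomic field `ℚ(ζ_ℓ)`. Since `End_δ(A)` is a free `ℤ`-module of finite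
  rank, it is integral over `ℤ[δ]`. Taking into account that `ℤ[δ] = ℤ[ζ_ℓ]` is integrally closed, we
  conclude that `ℤ[δ] = End_δ(A)` and we are done. Let us assume that `d = r²`. By Remark 2.17,
  `End_δ(A) = End_{ℤ[δ]}(Λ).`" — here the held draft BREAKS OFF (p0037 continues with the proof of
  Lemma 2.19 and §2.3): the last sentence of the theorem ("In the latter case, `A` is isogenous to
  `B^r` … `End_ℚ(B) ≅ ℚ(ζ_ℓ)`") has no proof in the source.

Yu. G. Zarhin, *Cyclic covers of the projective line, their jacobians and endomorphisms*, J. reine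
angew. Math. 544 (2002) (bib `Zarhin2002CyclicCovers`; held text `paper:arxiv-math_0008134`), proof of
Theorem 5.2 (p0012), the published form of the same argument, with `Λ` = the centralizer of `δ_p` in
`End(J)`, `η = 1 - δ_p`: "the natural map `Λ ⊗_{ℤ[δ_p]} ℤ[δ_p]/(η) → End_{𝔽_p}(J^{(f,p)}(η))` is an
embedding. Let us denote by `R` the image of this embedding. […] Clearly, `R` contains the identity
endomorphism and is stable under the conjugation via Galois automorphisms. Since the `Gal(K)`-module
`J^{(f,p)}(η)` is very simple, either `R = 𝔽_p · I` or `R = End_{𝔽_p}(J^{(f,p)}(η))`. If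
`Λ/ηΛ = R = 𝔽_p · I` then `Λ` coincides with `ℤ[δ_p]`. […] If `Λ/ηΛ = R = End_{𝔽_p}(J^{(f,p)}(η))`
then, by Nakayama's Lemma, `Λ ⊗ ℤ_p = End_{ℤ_p[δ_p]}T_p(J^{(f,p)}) ≅ Mat_{2g/(p-1)}(ℤ_p[δ_p])`. This
implies easily that the `ℚ(δ_p)`-algebra `Λ_ℚ = Λ ⊗ ℚ ⊂ End⁰(X)` has dimension `(2g/(p-1))²` and its
center has dimension `1`."

## Statement formalised — THEOREM 2.18 AT TORUS LEVEL (its first two alternatives), and the deviations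

`A = X = E/Φ(ℤ^ι)` a complex torus of positive dimension, `ℓ` a prime, `δ = ρ(D)` for an integer matrix
`D ∈ End(X) = endRingInt Φ` with `Φ_ℓ(D) = 0`; `A^δ = fixedSubgroup Φ D` (an `ℓ`-torsion group of order
`ℓ^r`, `r = rk Λ/(ℓ-1) = 2 dim X/(ℓ-1)`, gen 7), with ANY `𝔽_ℓ`-module structure (there is exactly one;
`fixedSubgroupModule` exhibits it) — taken as an instance hypothesis `[Module (ZMod ℓ) (fixedSubgroup Φ D)]`;
`End_δ(X) = centralizerEnd Φ D`, `End_{ℤ[δ]}(Λ) = Subring.centralizer {D} ⊆ M_ι(ℤ)`,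
`ℤ[δ] = Algebra.adjoin ℤ {D}`, `ℚ[δ] = Algebra.adjoin ℚ {D_ℚ} ⊆ M_ι(ℚ)` (a field `≅ ℚ(ζ_ℓ)` of degree
`ℓ - 1`, p10's `isField_adjoin_of_aeval_cyclotomic_eq_zero` / `finrank_adjoin_eq_totient`),
`End_ℚ(X)_δ =` the commutant of `D_ℚ` in `End_ℚ(X) = endAlgRat Φ`, and `R = fixedImage Φ D ℓ ⊆
End_{𝔽_ℓ}(A^δ)` the image of (2.19). **Theorem** (`dolgachevZarhin_2_18`): for ANY group `G` and ANY
representation `ρ : G → Aut_{𝔽_ℓ}(A^δ)` under which `R` is `G`-normal, if the `G`-module `A^δ` is very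
simple then EITHER `End_δ(X) = ℤ[δ]` (`centralizerEnd Φ D = ℤ[D]` as sets), OR `End_δ(X) = End_{ℤ[δ]}(Λ)`
(every integer matrix commuting with `D` is an endomorphism of `X`), in which case moreover every rational
matrix commuting with `D_ℚ` lies in `End_ℚ(X)` and `End_ℚ(X)_δ =` the commutant of `D_ℚ` in `M_ι(ℚ)`
`≅ Mat_r(ℚ[δ])` as `ℚ`-algebras.

`TODO(printed setting)`: in print `G = Gal(K)` acting on `A^δ ⊂ A[ℓ] ⊂ A(K̄)`, and the normality of `R`
comes from "`A` and `δ` are defined over `K`"; the analytic carrier has no model over `K` (lane note of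
seat p11 gen 7/8), so — exactly as for Theorem 2.15 in `ComplexTorusVerySimpleTorsion` — `G`, `ρ` are
arbitrary and the normality of `R` is the hypothesis `IsNormalSubalgebra ρ (fixedImage Φ D ℓ)`, which is
all the printed proof uses.

`DEVIATION (recorded)`: the printed rank count ("`End_δ(A)` is a projective `ℤ[δ]`-module of rank `d` …
`dim R = d` … `d = 1` or `d = r²`", and Remark 2.17's "comparing the ranks … there is `N`") is replaced
by NAKAYAMA'S LEMMA over `ℤ[δ]` (as in Zarhin 2002's published proof, "by Nakayama's Lemma"): from
`R = 𝔽_ℓ·Id`, resp. `R = End(A^δ)`, Lemma 2.19 (ii) gives `End_δ(A) = ℤ[δ] + (1-δ)End_δ(A)`, resp.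
`End_{ℤ[δ]}(Λ) = End_δ(A) + (1-δ)End_{ℤ[δ]}(Λ)` (Lemma 2.19 (ii) re-proved for the full commutant,
`centralizerAction_eq_zero_iff`), whence an `r(t) ∈ ℤ[t]` with `r(1) = 1` and
`r(δ)·End_δ(A) ⊆ ℤ[δ]`, resp. `r(δ)·End_{ℤ[δ]}(Λ) ⊆ End_δ(A)` (`exists_aeval_mul_mem_of_forall_eq_add`);
`Φ_ℓ ∤ r`, so `r(δ)` is invertible in `ℚ(δ)` and has an integer multiple `N = S r(δ)`, `S ∈ ℤ[δ]_ℚ ∩ M_ι(ℤ)`.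
Then: first case — `End_δ(A) ⊂ ℚ[δ]`, "integral … `ℤ[δ] = ℤ[ζ_ℓ]` is integrally closed" exactly as
printed (Mathlib's `IsCyclotomicExtension.Rat.isIntegralClosure_adjoin_singleton_of_prime`, transported
along `ℚ[δ] ≅ ℚ[t]/(Φ_ℓ) → ℚ(ζ_ℓ)`); second case — `N · End_{ℤ[δ]}(Λ) ⊂ End_δ(A)`, and Remark 2.17
(the tree's `mem_centralizerEnd_of_zsmul_mem`) gives (2.18); "`End_ℚ(A)_δ ≅ Mat_r(ℚ[δ])`" is then the
commutant of the field `ℚ[δ]` in `M_ι(ℚ)` (FILE 1, `Literature.LinearAlgebra.Matrix.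
nonempty_centralizer_singleton_algEquiv_matrix`).

NOT formalised: the last sentence of Theorem 2.18 ("`A` is isogenous to `B^r` … `End_ℚ(B) ≅ ℚ(ζ_ℓ)`"),
whose proof is absent from the held draft (see above; the published analogue, Zarhin 2002 Lemma 3.7,
asserts an isogeny `Z^r → J` with `ℚ(ζ_p) ⊂ End⁰(Z)`, `2 dim Z = p - 1`, not `End⁰(Z) = ℚ(ζ_p)`).
`-- TODO(Thm 2.18, last sentence): isogeny X ∼ B^r from the matrix units of End_ℚ(X)_δ ≅ Mat_r(ℚ[δ]).`

## References

* [DolgachevZarhin2024] I. Dolgachev, Yu. G. Zarhin, *Endomorphisms of Complex Abelian Varieties* (2024),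
  §2.2 (2.17)–(2.19), Remark 2.17, Theorem 2.18, Lemma 2.19 (held text p0035–p0037).
* [Zarhin2002CyclicCovers] Yu. G. Zarhin, *Cyclic covers of the projective line, their jacobians and
  endomorphisms*, J. reine angew. Math. 544 (2002) 91–110, §3 (the embedding `Λ/ηΛ ↪ End(J(η))`,
  p0007) and the proof of Thm. 5.2 (Nakayama, p0012).
* [Herstein1994] I. N. Herstein, *Noncommutative Rings*, §4.3 Thm. 4.3.2 (the commutant of a subfield; FILE 1).
-/

noncomputable section

open Module Matrix Function Polynomial
open Literature.RepresentationTheory Literature.LinearAlgebra.Matrix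

namespace Literature.Geometry.Kaehler

namespace ComplexTorus

open CyclotomicIdempotents

variable {ι : Type*} [Fintype ι] [DecidableEq ι] {E : Type*} [NormedAddCommGroup E] [NormedSpace ℂ E]

/-! ### §0 Integer/rational matrix helpers -/

section Helpers

omit [Fintype ι] [DecidableEq ι] in
/-- `ℤ → ℚ` on matrices is injective. [folklore] -/
private theorem map_intCast_injective :
    Function.Injective (fun A : Matrix ι ι ℤ ↦ A.map (Int.cast : ℤ → ℚ)) :=
  fun _ _ h ↦ Matrix.map_injective Int.cast_injective h

omit [DecidableEq ι] in
/-- `ℤ → ℚ` commutes with matrix products. [folklore] -/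
private theorem map_intCast_mul (A B : Matrix ι ι ℤ) :
    (A * B).map (Int.cast : ℤ → ℚ) = A.map (Int.cast : ℤ → ℚ) * B.map (Int.cast : ℤ → ℚ) :=
  Matrix.map_mul (f := Int.castRingHom ℚ)

/-- `ℤ → ℚ` commutes with polynomial evaluation on matrices. [folklore] -/
private theorem map_aeval_intCast (D : Matrix ι ι ℤ) (P : ℤ[X]) :
    (aeval D P).map (Int.cast : ℤ → ℚ) = aeval (D.map (Int.cast : ℤ → ℚ)) (P.map (Int.castRingHom ℚ)) := by
  have h := map_aeval_eq_aeval_map (S := Matrix ι ι ℤ) (U := Matrix ι ι ℚ) (φ := Int.castRingHom ℚ)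
    (ψ := (Int.castRingHom ℚ).mapMatrix) (RingHom.ext_int _ _) P D
  simpa only [RingHom.mapMatrix_apply, Int.coe_castRingHom] using h

omit [Fintype ι] [DecidableEq ι] in
/-- `(N • A).map = N • A.map`. [folklore] -/
private theorem map_intCast_zsmul (N : ℤ) (A : Matrix ι ι ℤ) :
    (N • A).map (Int.cast : ℤ → ℚ) = (N : ℚ) • A.map (Int.cast : ℤ → ℚ) := by
  ext i j
  simp only [Matrix.map_apply, Matrix.smul_apply, smul_eq_mul, Int.cast_mul]

/-- Cancelling a non-singular integer matrix on the right: `X B = Y B ⇒ X = Y`. [folklore] -/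
private theorem mul_right_cancel_of_det_ne_zero {B : Matrix ι ι ℤ} (hB : B.det ≠ 0) {X Y : Matrix ι ι ℤ}
    (h : X * B = Y * B) : X = Y := by
  have h' : B.det • X = B.det • Y := by
    rw [← Matrix.mul_one X, ← Matrix.mul_one Y, ← Matrix.mul_smul, ← Matrix.mul_smul, ← Matrix.mul_adjugate,
      ← Matrix.mul_assoc, ← Matrix.mul_assoc, h]
  ext i j
  have hij := congrFun (congrFun h' i) j
  rw [Matrix.smul_apply, Matrix.smul_apply, smul_eq_mul, smul_eq_mul] at hij
  exact mul_left_cancel₀ hB hij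

omit [Fintype ι] [DecidableEq ι] in
/-- Cancelling a non-zero integer scalar: `c X = c Y ⇒ X = Y`. [folklore] -/
private theorem smul_cancel_of_ne_zero {c : ℤ} (hc : c ≠ 0) {X Y : Matrix ι ι ℤ} (h : c • X = c • Y) :
    X = Y := by
  ext i j
  have hij := congrFun (congrFun h i) j
  rw [Matrix.smul_apply, Matrix.smul_apply, smul_eq_mul, smul_eq_mul] at hij
  exact mul_left_cancel₀ hc hij

/-- A polynomial in `D` commutes with every matrix commuting with `D`. [folklore] -/
private theorem aeval_mul_comm_of_comm {D S : Matrix ι ι ℤ} (hS : D * S = S * D) (r : ℤ[X]) :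
    aeval D r * S = S * aeval D r := by
  have hle : Algebra.adjoin ℤ ({D} : Set (Matrix ι ι ℤ)) ≤ Subalgebra.centralizer ℤ ({S} : Set (Matrix ι ι ℤ)) :=
    Algebra.adjoin_le (Set.singleton_subset_iff.2 ((Subalgebra.mem_centralizer_iff ℤ).2 fun y hy ↦ by
      rw [Set.mem_singleton_iff.1 hy]; exact hS.symm))
  exact ((Subalgebra.mem_centralizer_iff ℤ).1 (hle (aeval_mem_adjoin_singleton ℤ D)) S rfl).symm

/-- Integrality over `ℤ` is preserved by ring homomorphisms (any two ring maps `ℤ → B` agree). [folklore] -/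
private theorem isIntegral_int_map {A B : Type*} [Ring A] [Ring B] (f : A →+* B) {a : A}
    (ha : IsIntegral ℤ a) : IsIntegral ℤ (f a) := by
  obtain ⟨p, hp, hpa⟩ := ha
  refine ⟨p, hp, ?_⟩
  rw [show algebraMap ℤ B = f.comp (algebraMap ℤ A) from RingHom.ext_int _ _, ← Polynomial.hom_eval₂, hpa,
    map_zero]

/-- Integrality over `ℤ` descends along injective ring homomorphisms. [folklore] -/
private theorem isIntegral_int_of_map_injective {A B : Type*} [Ring A] [Ring B] (f : A →+* B)
    (hf : Function.Injective f) {a : A} (ha : IsIntegral ℤ (f a)) : IsIntegral ℤ a := by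
  obtain ⟨p, hp, hpa⟩ := ha
  refine ⟨p, hp, hf ?_⟩
  rw [Polynomial.hom_eval₂, show f.comp (algebraMap ℤ A) = algebraMap ℤ B from RingHom.ext_int _ _, hpa,
    map_zero]

end Helpers

/-! ### §1 `A^δ` as an `𝔽_ℓ`-vector space -/

section FixedModule

variable (Φ : (ι → ℝ) ≃L[ℝ] E) {D : Matrix ι ι ℤ} {ℓ : ℕ}

/-- **"`A^δ` is contained in `A[ℓ]`, and therefore, may be viewed as a finite-dimensional `𝔽_ℓ`-vector
space"**: the `𝔽_ℓ`-module structure of the `ℓ`-torsion group `A^δ` (`Φ_ℓ(δ) = 0`, `ℓ` prime). It is the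
only one (any `ZMod ℓ`-module structure on an abelian group is determined by the addition), which is why
the results below are stated for an arbitrary instance `[Module (ZMod ℓ) (fixedSubgroup Φ D)]`.
[cite: DolgachevZarhin2024, §2.2 (chunk p0033, "`A^δ` … may be viewed as a finite-dimensional `𝔽_ℓ`-vector space")] -/
abbrev fixedSubgroupModule (hℓ : ℓ.Prime) (hD : aeval D (cyclotomic ℓ ℤ) = 0) :
    Module (ZMod ℓ) (fixedSubgroup Φ D) :=
  AddCommGroup.zmodModule fun x ↦ Subtype.ext (prime_nsmul_eq_zero_of_mem_fixedSubgroup Φ hℓ hD x.2)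

/-- Under any `𝔽_ℓ`-structure, an integer `c` acts on `A^δ` as the residue class `c mod ℓ`. [folklore] -/
private theorem intCast_smul_fixed [Module (ZMod ℓ) (fixedSubgroup Φ D)] (c : ℤ) (t : fixedSubgroup Φ D) :
    (c : ZMod ℓ) • t = c • t :=
  Int.cast_smul_eq_zsmul (ZMod ℓ) c t

end FixedModule

/-! ### §2 The action of the commutant `End_{ℤ[δ]}(Λ)` on `A^δ`, and the subalgebra `R` of (2.19) -/

section Action

variable (Φ : (ι → ℝ) ≃L[ℝ] E) (D : Matrix ι ι ℤ) (ℓ : ℕ) [Module (ZMod ℓ) (fixedSubgroup Φ D)]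

/-- Membership in the commutant `End_{ℤ[δ]}(Λ)`: integer matrices commuting with `D`. [folklore] -/
private theorem mem_centralizer_singleton_iff {U : Matrix ι ι ℤ} :
    U ∈ Subring.centralizer ({D} : Set (Matrix ι ι ℤ)) ↔ D * U = U * D := by
  rw [Subring.mem_centralizer_iff]
  simp only [Set.mem_singleton_iff, forall_eq]

/-- **The action of `End_{ℤ[δ]}(Λ)` on `A^δ`** (Lemma 2.19 (i) needs only `uδ = δu`): an integer matrix
`U` commuting with `D` acts on `A^δ = Ker(1 - δ)` by `t ↦ ρ(U) t`, `𝔽_ℓ`-linearly; a ring homomorphism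
`End_{ℤ[δ]}(Λ) → End_{𝔽_ℓ}(A^δ)` extending the action (2.19) of `End_δ(A)`.
[cite: DolgachevZarhin2024, §2.2 Lemma 2.19 (i) and (2.19) (chunk p0036)] -/
def centralizerAction :
    Subring.centralizer ({D} : Set (Matrix ι ι ℤ)) →+* Module.End (ZMod ℓ) (fixedSubgroup Φ D) where
  toFun U := AddMonoidHom.toZModLinearMap ℓ
    { toFun := fun t ↦ ⟨mapMatrix Φ Φ (U : Matrix ι ι ℤ) t,
        mapMatrix_mem_fixedSubgroup Φ ((mem_centralizer_singleton_iff D).1 U.2) t.2⟩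
      map_zero' := Subtype.ext (map_zero (mapMatrixHom Φ Φ (U : Matrix ι ι ℤ)))
      map_add' := fun s t ↦
        Subtype.ext (mapMatrix_add (U : Matrix ι ι ℤ) (s : ComplexTorus Φ) (t : ComplexTorus Φ)) }
  map_one' := LinearMap.ext fun t ↦ Subtype.ext (mapMatrix_one (t : ComplexTorus Φ))
  map_mul' U U' := LinearMap.ext fun t ↦ Subtype.ext
    (mapMatrix_mapMatrix (Φ' := Φ) (Φ'' := Φ) (U : Matrix ι ι ℤ) (U' : Matrix ι ι ℤ)
      (t : ComplexTorus Φ)).symm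
  map_zero' := LinearMap.ext fun t ↦ Subtype.ext (mapMatrix_zero_matrix Φ Φ (t : ComplexTorus Φ))
  map_add' U U' := LinearMap.ext fun t ↦ Subtype.ext
    (mapMatrix_add_matrix Φ Φ (U : Matrix ι ι ℤ) (U' : Matrix ι ι ℤ) (t : ComplexTorus Φ))

/-- `centralizerAction U t = ρ(U) t`. [cite: DolgachevZarhin2024, §2.2 (2.19) (chunk p0036)] -/
theorem coe_centralizerAction_apply (U : Subring.centralizer ({D} : Set (Matrix ι ι ℤ)))
    (t : fixedSubgroup Φ D) :
    ((centralizerAction Φ D ℓ U t : fixedSubgroup Φ D) : ComplexTorus Φ) = mapMatrix Φ Φ (U : Matrix ι ι ℤ) t :=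
  rfl

/-- `centralizerAction U = 0` iff `ρ(U)` kills `A^δ`. [cite: DolgachevZarhin2024, §2.2 Lemma 2.19 (ii) (chunk p0036)] -/
theorem centralizerAction_eq_zero_iff_forall (U : Subring.centralizer ({D} : Set (Matrix ι ι ℤ))) :
    centralizerAction Φ D ℓ U = 0 ↔ ∀ t ∈ fixedSubgroup Φ D, mapMatrix Φ Φ (U : Matrix ι ι ℤ) t = 0 := by
  constructor
  · intro h t ht
    have h1 := congrArg (fun f : Module.End (ZMod ℓ) (fixedSubgroup Φ D) ↦
      ((f ⟨t, ht⟩ : fixedSubgroup Φ D) : ComplexTorus Φ)) h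
    simpa only [coe_centralizerAction_apply, LinearMap.zero_apply, ZeroMemClass.coe_zero] using h1
  · intro h
    exact LinearMap.ext fun t ↦ Subtype.ext ((coe_centralizerAction_apply Φ D ℓ U t).trans (h t t.2))

/-- An integer multiple of the identity acts on `A^δ` as the scalar `c mod ℓ`. [folklore] -/
private theorem centralizerAction_smul_one (c : ℤ)
    (h : c • (1 : Matrix ι ι ℤ) ∈ Subring.centralizer ({D} : Set (Matrix ι ι ℤ))) :
    centralizerAction Φ D ℓ ⟨c • 1, h⟩ = algebraMap (ZMod ℓ) (Module.End (ZMod ℓ) (fixedSubgroup Φ D)) c := by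
  refine LinearMap.ext fun t ↦ Subtype.ext ?_
  rw [coe_centralizerAction_apply, Module.algebraMap_end_apply, intCast_smul_fixed Φ c t]
  change mapMatrix Φ Φ (c • (1 : Matrix ι ι ℤ)) (t : ComplexTorus Φ) = ((c • t : fixedSubgroup Φ D) : ComplexTorus Φ)
  rw [mapMatrix_smul, mapMatrix_one, AddSubgroupClass.coe_zsmul]

/-- `c • 1` commutes with `D`. [folklore] -/
private theorem smul_one_mem_centralizer (c : ℤ) :
    c • (1 : Matrix ι ι ℤ) ∈ Subring.centralizer ({D} : Set (Matrix ι ι ℤ)) :=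
  (mem_centralizer_singleton_iff D).2 (by rw [Matrix.mul_smul, Matrix.smul_mul, Matrix.mul_one, Matrix.one_mul])

/-- **`R ⊂ End_{𝔽_ℓ}(A^δ)`, the image of the embedding (2.19)**: the `𝔽_ℓ`-subalgebra of `End_{𝔽_ℓ}(A^δ)`
of the restrictions `u|_{A^δ}`, `u ∈ End_δ(A)` (it contains the scalars, the restrictions of the
`c·1_A ∈ End_δ(A)`). [cite: DolgachevZarhin2024, §2.2 (2.19) ("the image `R` of the embedding (2.19)", chunk p0036)] [cite: Zarhin2002CyclicCovers, proof of Thm 5.2 ("Let us denote by `R` the image of this embedding", p0012)] -/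
def fixedImage : Subalgebra (ZMod ℓ) (Module.End (ZMod ℓ) (fixedSubgroup Φ D)) :=
  { ((centralizerAction Φ D ℓ).comp (Subring.inclusion (centralizerEnd_le_centralizer Φ D))).range.toSubsemiring with
    algebraMap_mem' := fun c ↦ by
      refine ⟨⟨((c.cast : ℤ)) • 1, mem_centralizerEnd_iff.2 ⟨zsmul_mem (Subring.one_mem _) _,
        by rw [Matrix.mul_smul, Matrix.smul_mul, Matrix.mul_one, Matrix.one_mul]⟩⟩, ?_⟩
      change centralizerAction Φ D ℓ ⟨((c.cast : ℤ)) • 1, _⟩ = _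
      rw [centralizerAction_smul_one, ZMod.intCast_zmod_cast] }

/-- Membership in `R`: the restrictions of the `u ∈ End_δ(A)`. [cite: DolgachevZarhin2024, §2.2 (2.19) (chunk p0036)] -/
theorem mem_fixedImage_iff {f : Module.End (ZMod ℓ) (fixedSubgroup Φ D)} :
    f ∈ fixedImage Φ D ℓ ↔ ∃ U : Matrix ι ι ℤ, ∃ hU : U ∈ centralizerEnd Φ D,
      centralizerAction Φ D ℓ ⟨U, centralizerEnd_le_centralizer Φ D hU⟩ = f := by
  change f ∈ ((centralizerAction Φ D ℓ).comp (Subring.inclusion (centralizerEnd_le_centralizer Φ D))).range ↔ _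
  rw [RingHom.mem_range]
  constructor
  · rintro ⟨⟨U, hU⟩, rfl⟩
    exact ⟨U, hU, rfl⟩
  · rintro ⟨U, hU, rfl⟩
    exact ⟨⟨U, hU⟩, rfl⟩

/-- The restriction of every `u ∈ End_δ(A)` lies in `R`. [cite: DolgachevZarhin2024, §2.2 (2.19) (chunk p0036)] -/
theorem centralizerAction_mem_fixedImage {U : Matrix ι ι ℤ} (hU : U ∈ centralizerEnd Φ D) :
    centralizerAction Φ D ℓ ⟨U, centralizerEnd_le_centralizer Φ D hU⟩ ∈ fixedImage Φ D ℓ :=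
  (mem_fixedImage_iff Φ D ℓ).2 ⟨U, hU, rfl⟩

end Action

/-! ### §3 Lemma 2.19 (ii) for the full commutant: the kernel of the action is `(1 - δ)End_{ℤ[δ]}(Λ)` -/

section Kernel

variable (Φ : (ι → ℝ) ≃L[ℝ] E) {D : Matrix ι ι ℤ} {ℓ : ℕ} [Module (ZMod ℓ) (fixedSubgroup Φ D)]

/-- **Lemma 2.19 (ii) for `End_{ℤ[δ]}(Λ)`**: an integer matrix `u` commuting with `δ` kills `A^δ` iff
`u ∈ (1 - δ)End_{ℤ[δ]}(Λ)`. The printed proof verbatim ("`v(1 - δ) = (1 - δ)v = ℓ` … `v(A[ℓ]) ⊂ A^δ` …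
`uv(A[ℓ]) = {0}` and, therefore, there is `w` … `vu = uv = ℓw = v(1 - δ)w` and, hence, `u = (1 - δ)w`.
Clearly `w ∈ End_δ(A)`"), which uses of `u` only that it commutes with `δ` — Claim 2.7 (`uv = ℓ w`) holds
for every integer matrix. [cite: DolgachevZarhin2024, §2.2 Lemma 2.19 (ii) and its proof (chunks p0036–p0037)] [cite: Zarhin2002CyclicCovers, §3 ("I claim that its kernel coincides with `ηΛ`", p0007)] -/
theorem centralizerAction_eq_zero_iff [Nonempty ι] (hℓ : ℓ.Prime) (hD : aeval D (cyclotomic ℓ ℤ) = 0)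
    (U : Subring.centralizer ({D} : Set (Matrix ι ι ℤ))) :
    centralizerAction Φ D ℓ U = 0 ↔
      ∃ W ∈ Subring.centralizer ({D} : Set (Matrix ι ι ℤ)), (U : Matrix ι ι ℤ) = (1 - D) * W := by
  haveI := Fact.mk hℓ
  obtain ⟨U, hU⟩ := U
  rw [centralizerAction_eq_zero_iff_forall]
  change (∀ t ∈ fixedSubgroup Φ D, mapMatrix Φ Φ U t = 0) ↔
    ∃ W ∈ Subring.centralizer ({D} : Set (Matrix ι ι ℤ)), U = (1 - D) * W
  have hDU : D * U = U * D := (mem_centralizer_singleton_iff D).1 hU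
  constructor
  · intro h0
    obtain ⟨V, -, hDV, hV1, hV2⟩ := exists_one_sub_mul_eq_smul hD
    rw [eval_one_cyclotomic_prime] at hV1 hV2
    -- `uv` kills `A[ℓ]`
    have hUV : ∀ t : ComplexTorus Φ, ℓ • t = 0 → mapMatrix Φ Φ (U * V) t = 0 := fun t ht ↦ by
      rw [← mapMatrix_mapMatrix (Φ' := Φ)]
      exact h0 _ (mapMatrix_mem_fixedSubgroup_of_torsion Φ hV1 (by rwa [natCast_zsmul]))
    -- Claim 2.7: `uv = ℓ w`
    obtain ⟨W, hW⟩ := (forall_torsion_imp_eq_zero_iff_exists_eq_smul Φ Φ (U * V) hℓ.pos).1 hUV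
    have hℓ0 : (ℓ : ℤ) ≠ 0 := Int.natCast_ne_zero.2 hℓ.ne_zero
    -- `u ℓ = u v (1 - δ) = ℓ w (1 - δ)`, so `u = w (1 - δ)`
    have hUW : U = W * (1 - D) := by
      refine smul_cancel_of_ne_zero hℓ0 ?_
      rw [← Matrix.smul_mul, ← hW, Matrix.mul_assoc, hV2, Matrix.mul_smul, Matrix.mul_one]
    -- `w` commutes with `δ`
    have hdet : (1 - D).det ≠ 0 := by
      rw [det_one_sub_eq_pow hℓ.pos hD, eval_one_cyclotomic_prime]
      exact pow_ne_zero _ hℓ0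
    have hDW : D * W = W * D := by
      refine mul_right_cancel_of_det_ne_zero hdet ?_
      have h1 : D * (1 - D) = (1 - D) * D := by rw [mul_sub, sub_mul, mul_one, one_mul]
      rw [Matrix.mul_assoc, ← hUW, Matrix.mul_assoc, h1, ← Matrix.mul_assoc, ← hUW, hDU]
    refine ⟨W, (mem_centralizer_singleton_iff D).2 hDW, ?_⟩
    rw [hUW, mul_sub, sub_mul, mul_one, one_mul, hDW]
  · rintro ⟨W, hW, hUW⟩ t ht
    have hDW : D * W = W * D := (mem_centralizer_singleton_iff D).1 hW
    have hc : (1 - D) * W = W * (1 - D) := by rw [sub_mul, mul_sub, one_mul, mul_one, hDW]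
    rw [mem_ker_mapMatrixHom_iff] at ht
    rw [hUW, hc, ← mapMatrix_mapMatrix (Φ' := Φ), ht]
    exact map_zero (mapMatrixHom Φ Φ W)

/-- The action of `u ∈ End_δ(A)` is that of `u ∈ End_{ℤ[δ]}(Λ)` (compatibility with gen 7's `fixedAction`).
[cite: DolgachevZarhin2024, §2.2 (2.19) (chunk p0036)] -/
theorem coe_centralizerAction_apply_eq_fixedAction (U : centralizerEnd Φ D) (t : fixedSubgroup Φ D) :
    ((centralizerAction Φ D ℓ ⟨U, centralizerEnd_le_centralizer Φ D U.2⟩ t : fixedSubgroup Φ D) :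
      ComplexTorus Φ) = ((fixedAction Φ D U t : fixedSubgroup Φ D) : ComplexTorus Φ) := rfl

end Kernel

/-! ### §4 `R = 𝔽_ℓ·Id` and `R = End(A^δ)` in terms of `End_δ(A)` and `End_{ℤ[δ]}(Λ)` -/

section Cases

variable (Φ : (ι → ℝ) ≃L[ℝ] E) {D : Matrix ι ι ℤ} {ℓ : ℕ} [Module (ZMod ℓ) (fixedSubgroup Φ D)]

/-- **`R = 𝔽_ℓ·Id` ⇒ `End_δ(A) = ℤ·1 + (1 - δ)End_δ(A)`**: if every `u ∈ End_δ(A)` acts on `A^δ` as a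
scalar, then `u = c·1 + (1 - δ)w` with `c ∈ ℤ`, `w ∈ End_δ(A)` (Lemma 2.19 (ii)).
[cite: DolgachevZarhin2024, §2.2 proof of Thm 2.18 ("`d = 1`", chunk p0036)] [cite: Zarhin2002CyclicCovers, proof of Thm 5.2 ("If `Λ/ηΛ = R = 𝔽_p · I` then `Λ` coincides with `ℤ[δ_p]`", p0012)] -/
theorem exists_eq_smul_one_add_of_fixedImage_eq_bot [Nonempty ι] (hℓ : ℓ.Prime)
    (hD : aeval D (cyclotomic ℓ ℤ) = 0) (hDe : D ∈ endRingInt Φ) (hbot : fixedImage Φ D ℓ = ⊥)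
    {U : Matrix ι ι ℤ} (hU : U ∈ centralizerEnd Φ D) :
    ∃ c : ℤ, ∃ W ∈ centralizerEnd Φ D, U = c • (1 : Matrix ι ι ℤ) + (1 - D) * W := by
  haveI := Fact.mk hℓ
  have hmem := centralizerAction_mem_fixedImage Φ D ℓ hU
  rw [hbot, Algebra.mem_bot, Set.mem_range] at hmem
  obtain ⟨c, hc⟩ := hmem
  -- `u - c̃·1` acts as `0`
  have hU' : U - ((c.cast : ℤ)) • (1 : Matrix ι ι ℤ) ∈ Subring.centralizer ({D} : Set (Matrix ι ι ℤ)) :=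
    Subring.sub_mem _ (centralizerEnd_le_centralizer Φ D hU) (smul_one_mem_centralizer D (c.cast : ℤ))
  have h0 : centralizerAction Φ D ℓ ⟨U - ((c.cast : ℤ)) • 1, hU'⟩ = 0 := by
    have h1 : (⟨U - ((c.cast : ℤ)) • 1, hU'⟩ : Subring.centralizer ({D} : Set (Matrix ι ι ℤ))) =
        ⟨U, centralizerEnd_le_centralizer Φ D hU⟩ - ⟨(c.cast : ℤ) • 1, smul_one_mem_centralizer D _⟩ := rfl
    rw [h1, map_sub, centralizerAction_smul_one, ZMod.intCast_zmod_cast, hc, sub_self]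
  obtain ⟨W, hW, hUW⟩ := (centralizerAction_eq_zero_iff Φ hℓ hD _).1 h0
  -- `w ∈ End(A)`: `(1 - δ) w = u - c·1 ∈ End(A)` … but we need `w` itself; `w` commutes with `δ` and
  -- `ℓ w = v (1 - δ) w ∈ End(A)` with `v ∈ ℤ[δ] ⊆ End(A)`, so `w ∈ End(A)` by saturation.
  have hDW : D * W = W * D := (mem_centralizer_singleton_iff D).1 hW
  obtain ⟨V, hVadj, -, -, hV2⟩ := exists_one_sub_mul_eq_smul hD
  rw [eval_one_cyclotomic_prime] at hV2
  have hVe : V ∈ endRingInt Φ := by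
    have hle : Algebra.adjoin ℤ ({D} : Set (Matrix ι ι ℤ)) ≤ subalgebraOfSubring (endRingInt Φ) :=
      Algebra.adjoin_le (Set.singleton_subset_iff.2 (mem_subalgebraOfSubring.2 hDe))
    exact mem_subalgebraOfSubring.1 (hle hVadj)
  have h1DW : (1 - D) * W ∈ endRingInt Φ := by
    rw [← hUW]
    exact (endRingInt Φ).sub_mem (mem_centralizerEnd_iff.1 hU).1 (zsmul_mem (Subring.one_mem _) _)
  have hℓ0 : (ℓ : ℤ) ≠ 0 := Int.natCast_ne_zero.2 hℓ.ne_zero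
  have hWe : W ∈ endRingInt Φ := by
    refine mem_endRingInt_of_smul_mem Φ hℓ0 ?_
    have : (ℓ : ℤ) • W = V * ((1 - D) * W) := by
      rw [← Matrix.mul_assoc, hV2, Matrix.smul_mul, Matrix.one_mul]
    rw [this]
    exact (endRingInt Φ).mul_mem hVe h1DW
  refine ⟨c.cast, W, mem_centralizerEnd_iff.2 ⟨hWe, hDW⟩, ?_⟩
  rw [← hUW, add_sub_cancel]

/-- **`R = End_{𝔽_ℓ}(A^δ)` ⇒ `End_{ℤ[δ]}(Λ) = End_δ(A) + (1 - δ)End_{ℤ[δ]}(Λ)`**: if every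
`𝔽_ℓ`-endomorphism of `A^δ` is the restriction of some `u₀ ∈ End_δ(A)`, then every integer matrix `u`
commuting with `δ` is `u₀ + (1 - δ)w`, `u₀ ∈ End_δ(A)`, `w` commuting with `δ` (Lemma 2.19 (ii) for the
commutant). [cite: DolgachevZarhin2024, §2.2 proof of Thm 2.18 ("`d = r²`", chunk p0037) and Remark 2.17] [cite: Zarhin2002CyclicCovers, proof of Thm 5.2 ("by Nakayama's Lemma", p0012)] -/
theorem exists_eq_add_of_fixedImage_eq_top [Nonempty ι] (hℓ : ℓ.Prime) (hD : aeval D (cyclotomic ℓ ℤ) = 0)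
    (htop : fixedImage Φ D ℓ = ⊤) {U : Matrix ι ι ℤ} (hU : U ∈ Subring.centralizer ({D} : Set (Matrix ι ι ℤ))) :
    ∃ U₀ ∈ centralizerEnd Φ D, ∃ W ∈ Subring.centralizer ({D} : Set (Matrix ι ι ℤ)), U = U₀ + (1 - D) * W := by
  have hmem : centralizerAction Φ D ℓ ⟨U, hU⟩ ∈ fixedImage Φ D ℓ := htop ▸ Algebra.mem_top
  obtain ⟨U₀, hU₀, h⟩ := (mem_fixedImage_iff Φ D ℓ).1 hmem
  have hU' : U - U₀ ∈ Subring.centralizer ({D} : Set (Matrix ι ι ℤ)) :=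
    Subring.sub_mem _ hU (centralizerEnd_le_centralizer Φ D hU₀)
  have h0 : centralizerAction Φ D ℓ ⟨U - U₀, hU'⟩ = 0 := by
    have h1 : (⟨U - U₀, hU'⟩ : Subring.centralizer ({D} : Set (Matrix ι ι ℤ))) =
        ⟨U, hU⟩ - ⟨U₀, centralizerEnd_le_centralizer Φ D hU₀⟩ := rfl
    rw [h1, map_sub, h, sub_self]
  obtain ⟨W, hW, hUW⟩ := (centralizerAction_eq_zero_iff Φ hℓ hD _).1 h0
  exact ⟨U₀, hU₀, W, hW, by rw [← hUW, add_sub_cancel]⟩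

end Cases

/-! ### §5 Nakayama's lemma over `ℤ[δ]` (replacing the rank count of Remark 2.17 / "`d ≤ r²`") -/

section Nakayama

variable {D : Matrix ι ι ℤ}

/-- Left multiplication by a polynomial in `D` preserves an additive subgroup stable under `D ·`. [folklore] -/
private theorem aeval_mul_mem_of_forall_mul_mem (N : AddSubgroup (Matrix ι ι ℤ)) (hN : ∀ U ∈ N, D * U ∈ N)
    (P : ℤ[X]) {U : Matrix ι ι ℤ} (hU : U ∈ N) : aeval D P * U ∈ N := by
  induction P using Polynomial.induction_on' with
  | add p q hp hq =>
    rw [map_add, add_mul]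
    exact N.add_mem hp hq
  | monomial n a =>
    rw [aeval_monomial, Algebra.algebraMap_eq_smul_one, Matrix.smul_mul, Matrix.one_mul, Matrix.smul_mul]
    refine N.zsmul_mem ?_ a
    induction n with
    | zero => rwa [pow_zero, Matrix.one_mul]
    | succ n ih =>
      rw [pow_succ', Matrix.mul_assoc]
      exact hN _ ih

/-- **Nakayama over `ℤ[δ]`.** Let `N`, `N'` be additive subgroups of `M_ι(ℤ)` stable under left
multiplication by `D`, with `N' ⊆ N + (1 - D)N'`. Then there is `r(t) ∈ ℤ[t]` with `r(1) = 1` and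
`r(D) · N' ⊆ N` (Mathlib's `Submodule.exists_sub_one_mem_and_smul_eq_zero_of_fg_of_le_smul` for the
`ℤ[t]`-module `N'/N`, `t` acting as `D`, and the ideal `(1 - t)`; `N'` is finitely generated because
`M_ι(ℤ)` is a Noetherian `ℤ`-module). This replaces "comparing the ranks in (2.17) … there is a positive
integer `N` such that `N · End_{ℤ[δ]}(Λ) ⊂ ι_r(End_δ(A))`". [cite: Zarhin2002CyclicCovers, proof of Thm 5.2 ("by Nakayama's Lemma", p0012)] [cite: DolgachevZarhin2024, §2.2 Remark 2.17 (chunk p0035)] -/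
theorem exists_aeval_mul_mem_of_forall_eq_add (N N' : AddSubgroup (Matrix ι ι ℤ))
    (hN : ∀ U ∈ N, D * U ∈ N) (hN' : ∀ U ∈ N', D * U ∈ N')
    (h : ∀ U ∈ N', ∃ V ∈ N, ∃ W ∈ N', U = V + (1 - D) * W) :
    ∃ r : ℤ[X], r.eval 1 = 1 ∧ ∀ U ∈ N', aeval D r * U ∈ N := by
  -- `M_ι(ℤ)` as a `ℤ[t]`-module, `t` acting by left multiplication by `D`
  letI inst : Module ℤ[X] (Matrix ι ι ℤ) := Module.compHom (Matrix ι ι ℤ) (aeval D : ℤ[X] →ₐ[ℤ] Matrix ι ι ℤ).toRingHom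
  have hsmul : ∀ (P : ℤ[X]) (U : Matrix ι ι ℤ), P • U = aeval D P * U := fun _ _ ↦ rfl
  -- the submodules `S ≤ S'` on `N ≤ N'`
  let S : Submodule ℤ[X] (Matrix ι ι ℤ) :=
    { carrier := N
      add_mem' := fun ha hb ↦ N.add_mem ha hb
      zero_mem' := N.zero_mem
      smul_mem' := fun P U hU ↦ by
        rw [hsmul]
        exact aeval_mul_mem_of_forall_mul_mem N hN P hU }
  let S' : Submodule ℤ[X] (Matrix ι ι ℤ) :=
    { carrier := N'
      add_mem' := fun ha hb ↦ N'.add_mem ha hb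
      zero_mem' := N'.zero_mem
      smul_mem' := fun P U hU ↦ by
        rw [hsmul]
        exact aeval_mul_mem_of_forall_mul_mem N' hN' P hU }
  -- the quotient module `N'/N`, realised as the image of `S'` in `M_ι(ℤ)/S`
  let Q : Submodule ℤ[X] (Matrix ι ι ℤ ⧸ S) := S'.map S.mkQ
  have hQfg : Q.FG := by
    refine Submodule.FG.map _ (Submodule.FG.of_restrictScalars ℤ ?_)
    exact IsNoetherian.noetherian _
  let I : Ideal ℤ[X] := Ideal.span {1 - X}
  have hQI : Q ≤ I • Q := by
    rintro _ ⟨U, hU, rfl⟩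
    obtain ⟨V, hV, W, hW, hUVW⟩ := h U hU
    have hV0 : S.mkQ V = 0 := (Submodule.Quotient.mk_eq_zero S).2 hV
    have hq : S.mkQ U = (1 - X : ℤ[X]) • S.mkQ W := by
      rw [← map_smul, hsmul, map_sub, map_one, aeval_X, hUVW, map_add, hV0, zero_add]
    rw [hq]
    exact Submodule.smul_mem_smul (Ideal.mem_span_singleton_self _) ⟨W, hW, rfl⟩
  obtain ⟨r, hr1, hr⟩ := Submodule.exists_sub_one_mem_and_smul_eq_zero_of_fg_of_le_smul I Q hQfg hQI
  refine ⟨r, ?_, fun U hU ↦ ?_⟩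
  · obtain ⟨a, ha⟩ := Ideal.mem_span_singleton'.1 hr1
    have := congrArg (Polynomial.eval 1) ha
    rw [eval_mul, eval_sub, eval_one, eval_X, sub_self, mul_zero, eval_sub, eval_one] at this
    linarith
  · have h0 := hr (S.mkQ U) ⟨U, hU, rfl⟩
    rw [← map_smul, Submodule.mkQ_apply, Submodule.Quotient.mk_eq_zero, hsmul] at h0
    exact h0

end Nakayama

/-! ### §6 `r(δ)` is invertible in `ℚ[δ]`, and has an integral multiple `N = S r(δ)` -/

section Inverse

variable {D : Matrix ι ι ℤ} {ℓ : ℕ}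

/-- `Φ_ℓ ∤ r` for `r(1) = 1` (`Φ_ℓ(1) = ℓ`). [folklore] -/
private theorem not_cyclotomic_dvd_of_eval_one (hℓ : ℓ.Prime) {r : ℤ[X]} (hr : r.eval 1 = 1) :
    ¬ cyclotomic ℓ ℤ ∣ r := by
  haveI := Fact.mk hℓ
  rintro ⟨q, rfl⟩
  rw [eval_mul, eval_one_cyclotomic_prime] at hr
  have h1 : (ℓ : ℤ) ∣ 1 := ⟨_, hr.symm⟩
  have := Int.eq_one_of_dvd_one (Int.natCast_nonneg ℓ) h1
  have h2 := hℓ.one_lt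
  omega

/-- **`r(δ)` is a unit of `ℚ[δ] ≅ ℚ(ζ_ℓ)`** when `r(1) = 1`: there is `b ∈ ℚ[t]` with
`b(δ) r(δ) = 1` in `M_ι(ℚ)` (Bezout with the irreducible `Φ_ℓ`, `Φ_ℓ ∤ r`).
[cite: DolgachevZarhin2024, §2.2 (2.16) ("`ℚ[δ] := ℤ[δ] ⊗ ℚ` … is isomorphic to the `ℓ`th cyclotomic field", chunk p0034)] -/
theorem exists_aeval_mul_aeval_eq_one [Nonempty ι] (hℓ : ℓ.Prime) (hD : aeval D (cyclotomic ℓ ℤ) = 0)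
    {r : ℤ[X]} (hr : r.eval 1 = 1) :
    ∃ b : ℚ[X], aeval (D.map (Int.cast : ℤ → ℚ)) b * (aeval D r).map (Int.cast : ℤ → ℚ) = 1 := by
  have hirr := cyclotomic.irreducible_rat hℓ.pos
  have hndvd : ¬ cyclotomic ℓ ℚ ∣ r.map (Int.castRingHom ℚ) := by
    rw [← map_cyclotomic_int]
    intro hdvd
    exact not_cyclotomic_dvd_of_eval_one hℓ hr ((Polynomial.map_dvd_map (Int.castRingHom ℚ)
      (Int.castRingHom ℚ).injective_int (cyclotomic.monic ℓ ℤ)).1 hdvd)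
  obtain ⟨a, b, hab⟩ := (hirr.coprime_iff_not_dvd.2 hndvd)
  refine ⟨b, ?_⟩
  have h := congrArg (aeval (D.map (Int.cast : ℤ → ℚ))) hab
  rw [map_add, map_mul, map_mul, aeval_map_cyclotomic_eq_zero hD, mul_zero, zero_add, map_one] at h
  rwa [map_aeval_intCast]

/-- **… and an integral multiple: `S r(δ) = N · 1`, `N ≠ 0`, with `S` an integer matrix commuting with
`δ`** (clear the denominators of `b(δ)`) — the "positive integer `N`" of Remark 2.17.
[cite: DolgachevZarhin2024, §2.2 Remark 2.17 ("there is a positive integer `N`", chunk p0035)] -/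
theorem exists_mul_aeval_eq_smul_one [Nonempty ι] (hℓ : ℓ.Prime) (hD : aeval D (cyclotomic ℓ ℤ) = 0)
    {r : ℤ[X]} (hr : r.eval 1 = 1) :
    ∃ S : Matrix ι ι ℤ, D * S = S * D ∧ ∃ N : ℤ, N ≠ 0 ∧ S * aeval D r = N • (1 : Matrix ι ι ℤ) := by
  obtain ⟨b, hb⟩ := exists_aeval_mul_aeval_eq_one hℓ hD hr
  obtain ⟨N, hN, S, hS⟩ := exists_intMatrix_map_eq_smul (aeval (D.map (Int.cast : ℤ → ℚ)) b)
  refine ⟨S, ?_, N, hN, ?_⟩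
  · apply map_intCast_injective
    change (D * S).map (Int.cast : ℤ → ℚ) = (S * D).map (Int.cast : ℤ → ℚ)
    have hc : D.map (Int.cast : ℤ → ℚ) * aeval (D.map (Int.cast : ℤ → ℚ)) b =
        aeval (D.map (Int.cast : ℤ → ℚ)) b * D.map (Int.cast : ℤ → ℚ) := by
      have h1 : aeval (D.map (Int.cast : ℤ → ℚ)) (X * b) = aeval (D.map (Int.cast : ℤ → ℚ)) (b * X) := by
        rw [mul_comm]
      rwa [map_mul, map_mul, aeval_X] at h1
    rw [map_intCast_mul, map_intCast_mul, hS, Matrix.mul_smul, Matrix.smul_mul, hc]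
  · apply map_intCast_injective
    change (S * aeval D r).map (Int.cast : ℤ → ℚ) = (N • (1 : Matrix ι ι ℤ)).map (Int.cast : ℤ → ℚ)
    rw [map_intCast_mul, hS, Matrix.smul_mul, hb, map_intCast_zsmul, Matrix.map_one _ Int.cast_zero Int.cast_one]
    exact (Int.cast_smul_eq_zsmul ℚ N _).symm

end Inverse

/-! ### §7 First alternative: `R = 𝔽_ℓ·Id` forces `End_δ(A) = ℤ[δ]` (`ℤ[ζ_ℓ]` is integrally closed) -/

section CaseBot

variable {D : Matrix ι ι ℤ} {ℓ : ℕ}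

/-- **"`ℤ[δ] = ℤ[ζ_ℓ]` is integrally closed"**: an element of the field `ℚ[δ] ⊆ M_ι(ℚ)` which is integral
over `ℤ` is a polynomial in `δ` with integer coefficients — Mathlib's
`IsCyclotomicExtension.Rat.isIntegralClosure_adjoin_singleton_of_prime` (`ℤ[ζ_ℓ]` is the ring of integers
of `ℚ(ζ_ℓ)`), transported along `ℚ[δ] ≅ ℚ[t]/(Φ_ℓ) → ℚ(ζ_ℓ)`, `δ ↦ ζ_ℓ`.
[cite: DolgachevZarhin2024, §2.2 proof of Thm 2.18 ("Taking into account that `ℤ[δ] = ℤ[ζ_ℓ]` is integrally closed", chunk p0036) and (2.16)] -/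
theorem exists_eq_aeval_of_isIntegral [Nonempty ι] (hℓ : ℓ.Prime) (hD : aeval D (cyclotomic ℓ ℤ) = 0)
    {x : Matrix ι ι ℚ} (hx : x ∈ Algebra.adjoin ℚ ({D.map (Int.cast : ℤ → ℚ)} : Set (Matrix ι ι ℚ)))
    (hint : IsIntegral ℤ x) : ∃ P : ℤ[X], x = (aeval D P).map (Int.cast : ℤ → ℚ) := by
  haveI := Fact.mk hℓ
  have hDq0 : aeval (D.map (Int.cast : ℤ → ℚ)) (cyclotomic ℓ ℚ) = 0 := aeval_map_cyclotomic_eq_zero hD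
  haveI : Fact (Irreducible (cyclotomic ℓ ℚ)) := ⟨cyclotomic.irreducible_rat hℓ.pos⟩
  -- `ℚ[t]/(Φ_ℓ) ≅ ℚ[δ]`
  let K : Subalgebra ℚ (Matrix ι ι ℚ) := Algebra.adjoin ℚ ({D.map (Int.cast : ℤ → ℚ)} : Set (Matrix ι ι ℚ))
  let e₁ : AdjoinRoot (cyclotomic ℓ ℚ) ≃ₐ[ℚ] K := adjoinRootCyclotomicEquiv hℓ.pos hDq0
  have hroot : ((e₁ (AdjoinRoot.root (cyclotomic ℓ ℚ)) : K) : Matrix ι ι ℚ) = D.map (Int.cast : ℤ → ℚ) :=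
    adjoinRootCyclotomicEquiv_root hℓ.pos hDq0
  -- `ℚ[t]/(Φ_ℓ) → ℚ(ζ_ℓ)`, `t ↦ ζ_ℓ`
  haveI : NeZero ℓ := ⟨hℓ.ne_zero⟩
  haveI : IsCyclotomicExtension {ℓ} ℚ (CyclotomicField ℓ ℚ) := CyclotomicField.isCyclotomicExtension ℓ ℚ
  set ζ : CyclotomicField ℓ ℚ := IsCyclotomicExtension.zeta ℓ ℚ (CyclotomicField ℓ ℚ) with hζdef
  have hζ : IsPrimitiveRoot ζ ℓ := IsCyclotomicExtension.zeta_spec ℓ ℚ (CyclotomicField ℓ ℚ)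
  have hζ0 : (cyclotomic ℓ ℚ).eval₂ (Algebra.ofId ℚ (CyclotomicField ℓ ℚ)) ζ = 0 := by
    have h := (isRoot_cyclotomic_iff (n := ℓ) (R := CyclotomicField ℓ ℚ)).2 hζ
    rw [← map_cyclotomic ℓ (algebraMap ℚ (CyclotomicField ℓ ℚ)), IsRoot.def, eval_map] at h
    exact h
  let ψ : AdjoinRoot (cyclotomic ℓ ℚ) →ₐ[ℚ] CyclotomicField ℓ ℚ :=
    AdjoinRoot.liftAlgHom _ (Algebra.ofId ℚ (CyclotomicField ℓ ℚ)) ζ hζ0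
  have hψ : Function.Injective ψ := (ψ : AdjoinRoot (cyclotomic ℓ ℚ) →+* CyclotomicField ℓ ℚ).injective
  have hψmk : ∀ P : ℤ[X], ψ (AdjoinRoot.mk (cyclotomic ℓ ℚ) (P.map (Int.castRingHom ℚ))) = aeval ζ P := by
    intro P
    change AdjoinRoot.liftAlgHom (cyclotomic ℓ ℚ) (Algebra.ofId ℚ (CyclotomicField ℓ ℚ)) ζ hζ0
      (AdjoinRoot.mk (cyclotomic ℓ ℚ) (P.map (Int.castRingHom ℚ))) = aeval ζ P
    rw [AdjoinRoot.liftAlgHom_mk, Polynomial.eval₂_map, aeval_def,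
      RingHom.ext_int (algebraMap ℤ (CyclotomicField ℓ ℚ))
        ((Algebra.ofId ℚ (CyclotomicField ℓ ℚ) : ℚ →+* CyclotomicField ℓ ℚ).comp (Int.castRingHom ℚ))]
  -- the element `a ∈ ℚ[t]/(Φ_ℓ)` corresponding to `x`, integral over `ℤ`; so is `ψ a ∈ ℚ(ζ_ℓ)`
  let y : K := ⟨x, hx⟩
  have hy : IsIntegral ℤ y := isIntegral_int_of_map_injective K.val.toRingHom Subtype.val_injective hint
  let a : AdjoinRoot (cyclotomic ℓ ℚ) := e₁.symm y
  have ha : IsIntegral ℤ a := isIntegral_int_map e₁.symm.toAlgHom.toRingHom hy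
  have hψa : IsIntegral ℤ (ψ a) := isIntegral_int_map ψ.toRingHom ha
  -- `ℤ[ζ_ℓ]` is integrally closed in `ℚ(ζ_ℓ)`: `ψ a = P(ζ_ℓ)` for some `P ∈ ℤ[t]`
  have hIC : IsIntegralClosure (Algebra.adjoin ℤ ({ζ} : Set (CyclotomicField ℓ ℚ))) ℤ (CyclotomicField ℓ ℚ) :=
    IsCyclotomicExtension.Rat.isIntegralClosure_adjoin_singleton_of_prime hζ
  obtain ⟨z, hz⟩ := hIC.isIntegral_iff.1 hψa
  have hzmem : (z : CyclotomicField ℓ ℚ) ∈ (aeval ζ : ℤ[X] →ₐ[ℤ] CyclotomicField ℓ ℚ).range := by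
    rw [← Algebra.adjoin_singleton_eq_range_aeval]
    exact z.2
  obtain ⟨P, hP⟩ := (AlgHom.mem_range _).1 hzmem
  refine ⟨P, ?_⟩
  -- hence `a = P(t)` (`ψ` is injective) and `x = P(δ)`
  have hlhs : ψ a = aeval ζ P := by
    rw [← hz, hP]
    rfl
  have hPa : a = AdjoinRoot.mk (cyclotomic ℓ ℚ) (P.map (Int.castRingHom ℚ)) := hψ (by rw [hlhs, hψmk])
  have hxa : x = ((e₁ a : K) : Matrix ι ι ℚ) := by
    change x = ((e₁ (e₁.symm y) : K) : Matrix ι ι ℚ)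
    rw [e₁.apply_symm_apply]
  rw [hxa, hPa, ← AdjoinRoot.aeval_eq, ← aeval_algHom_apply]
  change K.val (aeval (e₁ (AdjoinRoot.root (cyclotomic ℓ ℚ))) (P.map (Int.castRingHom ℚ))) = _
  rw [← aeval_algHom_apply, Subalgebra.coe_val, hroot, map_aeval_intCast]

variable (Φ : (ι → ℝ) ≃L[ℝ] E) [Module (ZMod ℓ) (fixedSubgroup Φ D)]

/-- `ℤ[δ] ⊆ End_δ(A)` (for `δ ∈ End(A)`). [cite: DolgachevZarhin2024, §2.2 ("the center of `End_δ(A)` contains `ℤ[δ]`", chunk p0035)] -/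
theorem adjoin_le_centralizerEnd (hDe : D ∈ endRingInt Φ) :
    ∀ U ∈ Algebra.adjoin ℤ ({D} : Set (Matrix ι ι ℤ)), U ∈ centralizerEnd Φ D := by
  intro U hU
  have hle : Algebra.adjoin ℤ ({D} : Set (Matrix ι ι ℤ)) ≤ subalgebraOfSubring (centralizerEnd Φ D) :=
    Algebra.adjoin_le (Set.singleton_subset_iff.2 (mem_subalgebraOfSubring.2
      (mem_centralizerEnd_iff.2 ⟨hDe, rfl⟩)))
  exact mem_subalgebraOfSubring.1 (hle hU)

/-- **Theorem 2.18, first alternative: `R = 𝔽_ℓ·Id` ⇒ `End_δ(A) = ℤ[δ]`.** If every `u ∈ End_δ(A)` acts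
on `A^δ` as a scalar, then every `u ∈ End_δ(A)` is a polynomial in `δ` with integer coefficients. Proof:
`End_δ(A) = ℤ[δ] + (1 - δ)End_δ(A)` (§4), so by Nakayama `r(δ)End_δ(A) ⊆ ℤ[δ]` with `r(1) = 1`, `r(δ)`
a unit of `ℚ[δ]`; hence "`ℤ[δ] ⊂ End_δ(A) ⊂ ℤ[δ] ⊗ ℚ` … `End_δ(A)` … is integral over `ℤ[δ]` … `ℤ[δ] =
ℤ[ζ_ℓ]` is integrally closed, we conclude that `ℤ[δ] = End_δ(A)`".
[cite: DolgachevZarhin2024, §2.2 Theorem 2.18 and its proof, case `d = 1` (chunk p0036)] [cite: Zarhin2002CyclicCovers, proof of Thm 5.2 ("If `Λ/ηΛ = R = 𝔽_p · I` then `Λ` coincides with `ℤ[δ_p]`", p0012)] -/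
theorem mem_adjoin_of_fixedImage_eq_bot [Nonempty ι] (hℓ : ℓ.Prime) (hD : aeval D (cyclotomic ℓ ℤ) = 0)
    (hDe : D ∈ endRingInt Φ) (hbot : fixedImage Φ D ℓ = ⊥) {U : Matrix ι ι ℤ} (hU : U ∈ centralizerEnd Φ D) :
    U ∈ Algebra.adjoin ℤ ({D} : Set (Matrix ι ι ℤ)) := by
  -- Nakayama: `r(δ) End_δ(A) ⊆ ℤ[δ]`
  obtain ⟨r, hr1, hr⟩ := exists_aeval_mul_mem_of_forall_eq_add
    (Algebra.adjoin ℤ ({D} : Set (Matrix ι ι ℤ))).toSubring.toAddSubgroup (centralizerEnd Φ D).toAddSubgroup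
    (fun V hV ↦ Subalgebra.mul_mem _ (Algebra.self_mem_adjoin_singleton ℤ D) hV)
    (fun V hV ↦ (centralizerEnd Φ D).mul_mem (mem_centralizerEnd_iff.2 ⟨hDe, rfl⟩) hV)
    (fun V hV ↦ by
      obtain ⟨c, W, hW, hVW⟩ := exists_eq_smul_one_add_of_fixedImage_eq_bot Φ hℓ hD hDe hbot hV
      exact ⟨c • 1, Subalgebra.zsmul_mem _ (Subalgebra.one_mem _) c, W, hW, hVW⟩)
  have hrU : aeval D r * U ∈ Algebra.adjoin ℤ ({D} : Set (Matrix ι ι ℤ)) := hr U hU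
  -- `u ∈ ℚ[δ]`: `u = b(δ) r(δ) u` with `b(δ) r(δ) = 1`
  obtain ⟨b, hb⟩ := exists_aeval_mul_aeval_eq_one hℓ hD hr1
  set Dq : Matrix ι ι ℚ := D.map (Int.cast : ℤ → ℚ) with hDq
  have hmemQ : U.map (Int.cast : ℤ → ℚ) ∈ Algebra.adjoin ℚ ({Dq} : Set (Matrix ι ι ℚ)) := by
    have h1 : U.map (Int.cast : ℤ → ℚ) = aeval Dq b * (aeval D r * U).map (Int.cast : ℤ → ℚ) := by
      rw [map_intCast_mul, ← Matrix.mul_assoc, hb, Matrix.one_mul]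
    rw [h1]
    refine Subalgebra.mul_mem _ (aeval_mem_adjoin_singleton ℚ Dq) ?_
    rw [Algebra.adjoin_singleton_eq_range_aeval] at hrU
    obtain ⟨P, hP⟩ := hrU
    rw [← hP]
    change (aeval D P).map (Int.cast : ℤ → ℚ) ∈ _
    rw [map_aeval_intCast]
    exact aeval_mem_adjoin_singleton ℚ Dq
  -- `u` is integral over `ℤ`
  have hint : IsIntegral ℤ (U.map (Int.cast : ℤ → ℚ)) :=
    IsIntegral.map ((Int.castRingHom ℚ).mapMatrix : Matrix ι ι ℤ →+* Matrix ι ι ℚ).toIntAlgHom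
      (Algebra.IsIntegral.isIntegral (R := ℤ) U)
  obtain ⟨P, hP⟩ := exists_eq_aeval_of_isIntegral hℓ hD hmemQ hint
  rw [map_intCast_injective hP]
  exact aeval_mem_adjoin_singleton ℤ D

/-- **`End_δ(A) = ℤ[δ]`** as sets, under the same hypotheses. [cite: DolgachevZarhin2024, §2.2 Theorem 2.18 (first alternative, chunk p0036)] -/
theorem coe_centralizerEnd_eq_adjoin_of_fixedImage_eq_bot [Nonempty ι] (hℓ : ℓ.Prime)
    (hD : aeval D (cyclotomic ℓ ℤ) = 0) (hDe : D ∈ endRingInt Φ) (hbot : fixedImage Φ D ℓ = ⊥) :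
    (centralizerEnd Φ D : Set (Matrix ι ι ℤ)) = Algebra.adjoin ℤ ({D} : Set (Matrix ι ι ℤ)) :=
  Set.Subset.antisymm (fun _ hU ↦ mem_adjoin_of_fixedImage_eq_bot Φ hℓ hD hDe hbot hU)
    (fun U hU ↦ adjoin_le_centralizerEnd Φ hDe U hU)

end CaseBot

/-! ### §8 Second alternative: `R = End(A^δ)` forces `End_δ(A) = End_{ℤ[δ]}(Λ)` and `End_ℚ(A)_δ ≅ Mat_r(ℚ[δ])` -/

section CaseTop

variable (Φ : (ι → ℝ) ≃L[ℝ] E) {D : Matrix ι ι ℤ} {ℓ : ℕ} [Module (ZMod ℓ) (fixedSubgroup Φ D)]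

/-- **Theorem 2.18, second alternative, (2.18): `R = End_{𝔽_ℓ}(A^δ)` ⇒ `End_δ(A) = End_{ℤ[δ]}(Λ)`** —
every integer matrix commuting with `δ` is an endomorphism of `X`. Proof: `End_{ℤ[δ]}(Λ) = End_δ(A) +
(1 - δ)End_{ℤ[δ]}(Λ)` (§4), Nakayama gives `r(δ)End_{ℤ[δ]}(Λ) ⊆ End_δ(A)`, hence
`N · End_{ℤ[δ]}(Λ) ⊆ End_δ(A)` with `N = S r(δ) ≠ 0`, and Remark 2.17 ("`Nu ∈ End_δ(A)` … we conclude
that `u ∈ End(A)`", the tree's `mem_centralizerEnd_of_zsmul_mem`) finishes.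
[cite: DolgachevZarhin2024, §2.2 Theorem 2.18 (proof, case `d = r²`) and Remark 2.17 / (2.18) (chunks p0035–p0037)] [cite: Zarhin2002CyclicCovers, proof of Thm 5.2 ("by Nakayama's Lemma, `Λ ⊗ ℤ_p = End_{ℤ_p[δ_p]}T_p`", p0012)] -/
theorem centralizer_le_endRingInt_of_fixedImage_eq_top [Nonempty ι] (hℓ : ℓ.Prime)
    (hD : aeval D (cyclotomic ℓ ℤ) = 0) (hDe : D ∈ endRingInt Φ) (htop : fixedImage Φ D ℓ = ⊤) :
    Subring.centralizer ({D} : Set (Matrix ι ι ℤ)) ≤ endRingInt Φ := by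
  -- Nakayama: `r(δ) End_{ℤ[δ]}(Λ) ⊆ End_δ(A)`
  obtain ⟨r, hr1, hr⟩ := exists_aeval_mul_mem_of_forall_eq_add
    (centralizerEnd Φ D).toAddSubgroup (Subring.centralizer ({D} : Set (Matrix ι ι ℤ))).toAddSubgroup
    (fun V hV ↦ (centralizerEnd Φ D).mul_mem (mem_centralizerEnd_iff.2 ⟨hDe, rfl⟩) hV)
    (fun V hV ↦ Subring.mul_mem _ ((mem_centralizer_singleton_iff D).2 rfl) hV)
    (fun V hV ↦ exists_eq_add_of_fixedImage_eq_top Φ hℓ hD htop hV)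
  -- `N = S r(δ)`
  obtain ⟨S, hDS, N, hN, hSr⟩ := exists_mul_aeval_eq_smul_one hℓ hD hr1
  intro U hU
  have hDU : D * U = U * D := (mem_centralizer_singleton_iff D).1 hU
  have hSU : S * U ∈ Subring.centralizer ({D} : Set (Matrix ι ι ℤ)) :=
    Subring.mul_mem _ ((mem_centralizer_singleton_iff D).2 hDS) hU
  have hNU : N • U ∈ centralizerEnd Φ D := by
    have h1 : N • U = aeval D r * (S * U) := by
      rw [← Matrix.mul_assoc, aeval_mul_comm_of_comm hDS, hSr, Matrix.smul_mul, Matrix.one_mul]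
    rw [h1]
    exact hr _ hSU
  exact (mem_centralizerEnd_iff.1 (mem_centralizerEnd_of_zsmul_mem Φ hN hDU hNU)).1

/-- (2.18) as an equality: `End_δ(A) = End_{ℤ[δ]}(Λ)`. [cite: DolgachevZarhin2024, §2.2 (2.18) and Theorem 2.18 (chunks p0035–p0037)] -/
theorem centralizerEnd_eq_centralizer_of_fixedImage_eq_top [Nonempty ι] (hℓ : ℓ.Prime)
    (hD : aeval D (cyclotomic ℓ ℤ) = 0) (hDe : D ∈ endRingInt Φ) (htop : fixedImage Φ D ℓ = ⊤) :
    centralizerEnd Φ D = Subring.centralizer ({D} : Set (Matrix ι ι ℤ)) :=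
  le_antisymm (centralizerEnd_le_centralizer Φ D) fun _ hU ↦
    mem_centralizerEnd_iff.2 ⟨centralizer_le_endRingInt_of_fixedImage_eq_top Φ hℓ hD hDe htop hU,
      (mem_centralizer_singleton_iff D).1 hU⟩

/-- **`End_ℚ(A)_δ` is the full commutant of `δ` in `M_ι(ℚ)`** in the second alternative: every rational
matrix commuting with `D_ℚ` lies in `End_ℚ(X)` (clear denominators and use (2.18)).
[cite: DolgachevZarhin2024, §2.2 Theorem 2.18 ("`End_ℚ(A)_δ = End(A)_δ ⊗ ℚ`", chunk p0036)] -/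
theorem centralizer_le_endAlgRat_of_fixedImage_eq_top [Nonempty ι] (hℓ : ℓ.Prime)
    (hD : aeval D (cyclotomic ℓ ℤ) = 0) (hDe : D ∈ endRingInt Φ) (htop : fixedImage Φ D ℓ = ⊤) :
    Subalgebra.centralizer ℚ ({D.map (Int.cast : ℤ → ℚ)} : Set (Matrix ι ι ℚ)) ≤ endAlgRat Φ := by
  intro B hB
  rw [Subalgebra.mem_centralizer_iff] at hB
  have hDB := hB _ rfl
  obtain ⟨d, hd, A, hAB⟩ := exists_intMatrix_map_eq_smul B
  -- `A = d B` commutes with `D`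
  have hDA : D * A = A * D := by
    apply map_intCast_injective
    change (D * A).map (Int.cast : ℤ → ℚ) = (A * D).map (Int.cast : ℤ → ℚ)
    rw [map_intCast_mul, map_intCast_mul, hAB, Matrix.mul_smul, Matrix.smul_mul, hDB]
  have hA : A ∈ endRingInt Φ :=
    centralizer_le_endRingInt_of_fixedImage_eq_top Φ hℓ hD hDe htop ((mem_centralizer_singleton_iff D).2 hDA)
  rw [mem_endRingInt_iff, hAB] at hA
  have hd' : (d : ℚ) ≠ 0 := Int.cast_ne_zero.2 hd
  have hB' : B = (d : ℚ)⁻¹ • ((d : ℚ) • B) := by rw [smul_smul, inv_mul_cancel₀ hd', one_smul]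
  rw [hB', ← Int.cast_smul_eq_zsmul ℚ d B] at *
  exact (endAlgRat Φ).smul_mem (by rwa [Int.cast_smul_eq_zsmul] ) _

/-- **Theorem 2.18, second alternative: "`End_ℚ(A)_δ` is isomorphic to the matrix algebra of size `r` over
the field `ℚ[δ]`"**, `r = rk Λ/(ℓ - 1) = 2 dim(A)/(ℓ - 1)`: in the second alternative `End_ℚ(A)_δ` is the
commutant of the field `ℚ[δ]` (`≅ ℚ(ζ_ℓ)`, degree `ℓ - 1`) in `M_ι(ℚ) = End_ℚ(Λ ⊗ ℚ)`, a matrix algebra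
`Mat_r(ℚ[δ])` (FILE 1). [cite: DolgachevZarhin2024, §2.2 Theorem 2.18 (second alternative, chunk p0036)] [cite: Zarhin2002CyclicCovers, proof of Thm 5.2 ("`Λ_ℚ` … has dimension `(2g/(p-1))²` and its center has dimension `1`", p0012)] -/
theorem nonempty_centralizer_algEquiv_matrix [Nonempty ι] (hℓ : ℓ.Prime) (hD : aeval D (cyclotomic ℓ ℤ) = 0) :
    Nonempty (Subalgebra.centralizer ℚ ({D.map (Int.cast : ℤ → ℚ)} : Set (Matrix ι ι ℚ)) ≃ₐ[ℚ]
      Matrix (Fin (Fintype.card ι / (ℓ - 1))) (Fin (Fintype.card ι / (ℓ - 1)))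
        (Algebra.adjoin ℚ ({D.map (Int.cast : ℤ → ℚ)} : Set (Matrix ι ι ℚ)))) := by
  have hDq0 : aeval (D.map (Int.cast : ℤ → ℚ)) (cyclotomic ℓ ℚ) = 0 := aeval_map_cyclotomic_eq_zero hD
  have hK := isField_adjoin_of_aeval_cyclotomic_eq_zero hℓ.pos hDq0
  obtain ⟨e⟩ := nonempty_centralizer_singleton_algEquiv_matrix (D.map (Int.cast : ℤ → ℚ)) hK
  have hr : Fintype.card ι / finrank ℚ (Algebra.adjoin ℚ ({D.map (Int.cast : ℤ → ℚ)} : Set (Matrix ι ι ℚ))) =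
      Fintype.card ι / (ℓ - 1) := by
    rw [finrank_adjoin_eq_totient hℓ.pos hDq0, Nat.totient_prime hℓ]
  exact ⟨e.trans (Matrix.reindexAlgEquiv ℚ _ (finCongr hr))⟩

end CaseTop

/-! ### §9 Theorem 2.18 -/

section Main

variable (Φ : (ι → ℝ) ≃L[ℝ] E) {D : Matrix ι ι ℤ} {ℓ : ℕ} [Module (ZMod ℓ) (fixedSubgroup Φ D)]

/-- **Dolgachev–Zarhin, Theorem 2.18 (at torus level; its first two alternatives).** Let `X = E/Φ(ℤ^ι)`
be a complex torus of positive dimension, `ℓ` a prime, `δ = ρ(D) ∈ End(X)` with `Φ_ℓ(δ) = 0`, `A^δ` its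
fixed group (an `𝔽_ℓ`-space of dimension `r = 2 dim X/(ℓ - 1)`), `End_δ(X)` the centralizer of `δ` in
`End(X)`, and `R ⊂ End_{𝔽_ℓ}(A^δ)` the image of (2.19). Let `ρ : G → Aut_{𝔽_ℓ}(A^δ)` be a representation
of a group `G` under which `R` is `G`-normal (in print `G = Gal(K)`, "since `A` and `δ` are defined over
`K`"). If the `G`-module `A^δ` is very simple, then EITHER `End_δ(X) = ℤ[δ]`, OR `End_δ(X) = End_{ℤ[δ]}(Λ)`
(every integer matrix commuting with `δ` is holomorphic), every rational matrix commuting with `δ` lies in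
`End_ℚ(X)`, and `End_ℚ(X)_δ` — the commutant of `δ` — is `≅ Mat_r(ℚ[δ])` as a `ℚ`-algebra.
`-- TODO(printed setting): G = Gal(K); no model over K on the analytic carrier.`
`-- TODO(Thm 2.18, last sentence): "A ∼ B^r, dim B = (ℓ-1)/2, End_ℚ(B) ≅ ℚ(ζ_ℓ)" — no proof in the held draft.`
[cite: DolgachevZarhin2024, §2.2 Theorem 2.18 (chunks p0036–p0037)] [cite: Zarhin2002CyclicCovers, Thm 5.2 (proof, p0012)] -/
theorem dolgachevZarhin_2_18 [Nonempty ι] (hℓ : ℓ.Prime) (hD : aeval D (cyclotomic ℓ ℤ) = 0)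
    (hDe : D ∈ endRingInt Φ) {G : Type*} [Group G] {ρ : Representation (ZMod ℓ) G (fixedSubgroup Φ D)}
    (hnorm : IsNormalSubalgebra ρ (fixedImage Φ D ℓ)) (hvs : IsVerySimple ρ) :
    (centralizerEnd Φ D : Set (Matrix ι ι ℤ)) = Algebra.adjoin ℤ ({D} : Set (Matrix ι ι ℤ)) ∨
    (centralizerEnd Φ D = Subring.centralizer ({D} : Set (Matrix ι ι ℤ)) ∧
      Subalgebra.centralizer ℚ ({D.map (Int.cast : ℤ → ℚ)} : Set (Matrix ι ι ℚ)) ≤ endAlgRat Φ ∧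
      Nonempty (Subalgebra.centralizer ℚ ({D.map (Int.cast : ℤ → ℚ)} : Set (Matrix ι ι ℚ)) ≃ₐ[ℚ]
        Matrix (Fin (Fintype.card ι / (ℓ - 1))) (Fin (Fintype.card ι / (ℓ - 1)))
          (Algebra.adjoin ℚ ({D.map (Int.cast : ℤ → ℚ)} : Set (Matrix ι ι ℚ))))) := by
  haveI := Fact.mk hℓ
  -- "Since the Galois module `A^δ` is very simple, either `R = 𝔽_ℓ·Id` or `R = End(A^δ)`"
  rcases hvs.eq_bot_or_eq_top hnorm with hbot | htop
  · exact Or.inl (coe_centralizerEnd_eq_adjoin_of_fixedImage_eq_bot Φ hℓ hD hDe hbot)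
  · exact Or.inr ⟨centralizerEnd_eq_centralizer_of_fixedImage_eq_top Φ hℓ hD hDe htop,
      centralizer_le_endAlgRat_of_fixedImage_eq_top Φ hℓ hD hDe htop,
      nonempty_centralizer_algEquiv_matrix hℓ hD⟩

/-- **Theorem 2.18, "`End(A)_δ = ℤ[δ]`" read as maximal commutativity** (Zarhin 2002, Thm 5.2: "`ℚ(δ_p)`
coincides with its own centralizer"): in the first alternative every endomorphism of `X` commuting with `δ`
is a polynomial in `δ`; in particular `End_δ(X)` is commutative. [cite: DolgachevZarhin2024, §2.2 Theorem 2.18 (chunk p0036)] [cite: Zarhin2002CyclicCovers, Thm 5.2 (p0012)] -/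
theorem centralizerEnd_comm_of_fixedImage_eq_bot [Nonempty ι] (hℓ : ℓ.Prime)
    (hD : aeval D (cyclotomic ℓ ℤ) = 0) (hDe : D ∈ endRingInt Φ) (hbot : fixedImage Φ D ℓ = ⊥)
    {U U' : Matrix ι ι ℤ} (hU : U ∈ centralizerEnd Φ D) (hU' : U' ∈ centralizerEnd Φ D) :
    U * U' = U' * U := by
  have h := mem_adjoin_of_fixedImage_eq_bot Φ hℓ hD hDe hbot hU
  have h' := mem_adjoin_of_fixedImage_eq_bot Φ hℓ hD hDe hbot hU'
  rw [Algebra.adjoin_singleton_eq_range_aeval, AlgHom.mem_range] at h h'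
  obtain ⟨P, rfl⟩ := h
  obtain ⟨Q, rfl⟩ := h'
  exact ((Commute.all P Q).map (aeval D)).eq

end Main

end ComplexTorus

end Literature.Geometry.Kaehler

end
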